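import Literature.NumberTheory.EllipticCurves.Rank1Residual.Typed.PAdicCertificateMultiplicativeExists
import Literature.NumberTheory.EllipticCurves.PAdicHeightsLInvariantHoldsProofs
import Summits.BirchSwinnertonDyer.Rank1Residual.Partition.Rows
import HarnessLib

/-!
# BSD rank-≤1 residual cell, class X11b at `p ≥ 5` WITHOUT a divisibility source (`¬surj ∧ ¬ram`):
# the missing input TYPED at the pair — the integral multiplicative main-conjecture DIVISIBILITY at
# `(E, p)` — and the kernel theorem "that input + the two-number `p`-adic certificate ⇒ `BSD(E,p)`"

HONEST FRAMING (cell `b2b-bsdres-*`, verbatim): prove what is provable now; shrink each hard class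
to its core with data; no claim beyond stated classes; COMBINATION classes deleted from PUBLISHED
theorems only, CONSTRUCTION-shaped remainder typed; this is not "finishing BSD". Class X11b stays
CONSTRUCTION-SHAPED; nothing here is a class theorem over elliptic curves, no lane verdict changes,
NO named fact is minted: the one definition of this file is a typed MISSING INPUT (a `Prop` on the
pair `(W, p)`, nothing asserted), exactly like `Typed.X11RankZero.MissingInputAt` /
`X9/IwasawaLowerBound`.

Unit `b2b-bsdres-x11c`, gen 5. WHY. The per-pair `p`-adic certificate route of this unit
(`X11RankOneCertificates/Claim.lean`, x11a's `Typed/PAdicCertificate*.lean`) needs a DIVISIBILITY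
SOURCE at the multiplicative prime `p`: Skinner 2016 Thm. A under (irr) + (ram)
(`Skinner2016.thmA_charIdeal_multiplicative`, A31) or Kato's divisibility under a surjective
`ρ_{E,p^∞}` (`Wuthrich2014.kato_charIdeal_dvd_multiplicative_of_surjective`, A32). On the unit's
census (X11 ∧ `r = 1` ∧ ¬sst ∧ `p ≥ 5`, Cremona `N < 5·10⁵`) 64 pairs have NEITHER (images 5S4 /
5Ns, no (ram) prime; HOME/b2b-bsdres-x11c/RESISTANT.md §A); gens 3–4 closed 61 of them per pair by
Heegner-index certificates, and 3 (`84960d1`, `296240ce1`, `304560by1` @ 5: two bad primes with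
`5 ∥ c_q`) resist every printed lever (RESISTANT.md gen-5 UPDATE: the Euler-system integrality
hypothesis `Hyp(ℚ_∞,T)(i)` — a `τ` with `T/(τ−1)T` free of rank one — fails for an image of order
prime to `p`; Heegner-index bounds subtract only `max_q ord_p c_q`; exact `5`-descent needs the class
group of a degree-24 field). This file TYPES what is missing there, at the pair, in the tree's
vocabulary, and proves that it is ALL that is missing modulo the same finite certificate the other
82 + 85 pairs carry:

* `MultDivisibilityAt W p` — the integral cyclotomic main-conjecture DIVISIBILITY at `(E, p)`,
  `p ∥ N`: `X(E/ℚ_∞)` is `Λ`-torsion and `ϖ · L_p(E,T) = ι(g)` (non-split) resp. `= T · ι(g)` (split)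
  for some `g ∈ char_Λ X(E/ℚ_∞)` — LITERALLY the conclusion of A32 at the pair, with NO hypothesis
  on the image of `ρ̄_{E,p}` and no (ram) prime. Construction-shaped: for irreducible non-surjective
  images at `p ∥ N` no published or announced theorem supplies it (the multiplicative analogue of
  X9's missing input; Burungale–Castella–Skinner 2025 / Yan–Zhu 2026 need GOOD ordinary `p`).
* `multDivisibilityAt_of_surj` (A32 ⇒ it, `p ≥ 5`, `ρ̄_{E,p}` onto) and `multDivisibilityAt_of_ram`
  (A31 ⇒ it, `p ≥ 3`, (irr) + (ram)) — the two PUBLISHED sources are instances, so the typed input is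
  the exact common generalisation the 64 pairs lack.
* `bsdp_of_multDivisibilityAt_split_of_certificate` / `…_nonsplit_…` — for ANY globally minimal
  elliptic `W/ℚ`, `p ≥ 3`, analytic rank `≤ 1`: `MultDivisibilityAt W p` + the PUBLISHED leading-term
  facts (Stein–Wuthrich 2013 Thm. 6.1 `hJ`, §4.2 height existence `hH`, GZK; the `𝓛`-invariant is
  non-zero by the tree THEOREM `LInvariant_ne_zero_holds`) + the per-pair COMPUTED certificate
  (`ord_{T=0} L_p = r + e`, the valuation identity for THE Stein–Wuthrich regulator — the two numbers
  of the unit's records) + `p ∤ #Ш_an` ⟹ `BSDp W p`. No (irr), no (ram), no surjectivity, no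
  semistability, no class predicate: the divisibility is the ONLY non-computational input.
* `ClassX11b.bsdp_of_multDivisibilityAt_{split,nonsplit}_of_certificate` — the same on the cell's
  v5 class X11b (`r_an = 1 ∧ p ≠ 2 ∧ mult ∧ irr`).

So the CORE of the three resistant pairs (and of every X11b pair at `p ≥ 5`) is ONE typed statement
each, `MultDivisibilityAt E 5`, plus a finite two-engine computation; nothing else. Proof pattern =
x11a's `Typed/PAdicCertificateSurjective.lean` + `…Canonical.lean` + `…Exists.lean` with the named
fact replaced by the typed input (engine `Typed.noPTorsion_of_leadingTerm_certificate`).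

References: Skinner, Pacific J. Math. 283 (2016) Thm. A [Skinner2016PacificMC]; Wuthrich, Doc.
Math. 19 (2014) Thm. 3, Cor. 19 [Wuthrich2014]; Kato, Astérisque 295 (2004) Thm. 17.4; Rubin,
"Euler systems and modular elliptic curves" (in Galois Representations in Arithmetic Algebraic
Geometry, CUP 1998) Hyp(ℚ_∞,T), Prop. 8.3, Thms. 8.7–8.8; Stein–Wuthrich, Math. Comp. 82 (2013)
Thm. 6.1, §4.2 [SteinWuthrich2013]; Mazur–Tate–Teitelbaum 1986 §II.10
[MazurTateTeitelbaum1986Invent]; Miller 2011 Prop. 7.6 [Miller2011LMS].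
-/

set_option autoImplicit false

noncomputable section

open scoped Classical MatrixGroups ModularForm

open CongruenceSubgroup WeierstrassCurve Literature.NumberTheory.EllipticCurves
  Literature.NumberTheory.EllipticCurves.ModularForms
  Literature.NumberTheory.EllipticCurves.Rank1Residual
  Literature.NumberTheory.EllipticCurves.Rank1Residual.Typed
  Literature.NumberTheory.EllipticCurves.Skinner2016
  Literature.NumberTheory.EllipticCurves.Wuthrich2014
  Literature.NumberTheory.EllipticCurves.SteinWuthrich2013

namespace Summit.BirchSwinnertonDyer.Rank1Residual.X11b

/-! ### §1. The typed missing input at the pair -/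

/-- **MISSING INPUT (construction-shaped; NOT a cited fact; nothing in print or announced supplies it
for an irreducible NON-surjective image without a (ram) prime).** The integral cyclotomic
main-conjecture DIVISIBILITY at the pair `(E, p)`, `p ∥ N`, in the shape the `p`-adic certificate
engine consumes: for every cyclotomic datum `(κ, γ)`, newform `f` of `E`, Selmer-dual datum `D` and
period ratio `ϖ ≠ 0` with `ϖ · Ω_E = Ω⁺_f`: `X(E/ℚ_∞)` is `Λ`-torsion, and for THE `p`-adic
`L`-function `L` of `f` one has `ϖ · L = ι(g)` (non-split `p`) resp. `ϖ · L = T · ι(g)` (split `p`,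
the exceptional zero) for some `g ∈ char_Λ X`. Word for word the conclusion of the named fact
`Wuthrich2014.kato_charIdeal_dvd_multiplicative_of_surjective` (A32) at `(W, p)`, WITHOUT its
image hypothesis (and under the harmless extra premise `ϖ ≠ 0` that every consumer carries); also
implied by Skinner 2016 Thm. A (A31) under (irr) + (ram) (`multDivisibilityAt_of_ram`). A predicate
on `(W, p)`; nothing asserted; for a `5S4`/`5Ns` image without a (ram) prime no published or
announced theorem supplies it (RESISTANT.md gen-5 UPDATE).
[cite: Wuthrich2014, Thm. 3 (p. 383) and Cor. 19 (p. 398) (shape only; nothing asserted)]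
[cite: Skinner2016PacificMC, Thm. A (§1) (shape only; nothing asserted)] -/
def MultDivisibilityAt (W : WeierstrassCurve ℚ) [W.IsElliptic] [W.IsGloballyMinimal] (p : ℕ)
    [Fact p.Prime] : Prop :=
  ∀ {κ : ZpExtension ℚ p} {γ : Field.absoluteGaloisGroup ℚ} {N : ℕ} [NeZero N]
    {f : CuspForm (Gamma0 N) 2},
    κ.IsCyclotomic → κ.IsTopGenerator γ → IsCyclotomicVariable p γ → IsNewformOf W f →
    ∀ (D : W.SelmerDualData κ γ) (ϖ : ℚ), ϖ ≠ 0 → (ϖ : ℝ) * W.realPeriodRat = plusPeriod f →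
      D.IsTorsion ∧
      (¬ W.HasSplitMultiplicativeReductionAtPrime p →
        ∀ L : PowerSeries ℚ_[p], IsMultPAdicLFunctionOf f p (-1) L →
          ∃ g ∈ D.charIdeal, iwasawaToPowerSeries p g = PowerSeries.C ((ϖ : ℚ) : ℚ_[p]) * L) ∧
      (W.HasSplitMultiplicativeReductionAtPrime p →
        ∀ L : PowerSeries ℚ_[p], IsSplitMultPAdicLFunctionOf f p L →
          ∃ g ∈ D.charIdeal, iwasawaToPowerSeries p (PowerSeries.X * g) =
            PowerSeries.C ((ϖ : ℚ) : ℚ_[p]) * L)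

/-! ### §2. Projections of the typed input (the engine shapes) -/

namespace MultDivisibilityAt

/-- First clause: `X(E/ℚ_∞)` is `Λ`-torsion. [folklore] -/
theorem isTorsion {W : WeierstrassCurve ℚ} [W.IsElliptic] [W.IsGloballyMinimal] {p : ℕ}
    [Fact p.Prime] (hdiv : MultDivisibilityAt W p)
    {κ : ZpExtension ℚ p} {γ : Field.absoluteGaloisGroup ℚ} {N : ℕ} [NeZero N]
    {f : CuspForm (Gamma0 N) 2} (hκ : κ.IsCyclotomic) (hγ : κ.IsTopGenerator γ)
    (hγ' : IsCyclotomicVariable p γ) (hf : IsNewformOf W f) (D : W.SelmerDualData κ γ) (ϖ : ℚ)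
    (hϖ0 : ϖ ≠ 0) (hϖ : (ϖ : ℝ) * W.realPeriodRat = plusPeriod f) : D.IsTorsion :=
  (hdiv hκ hγ hγ' hf D ϖ hϖ0 hϖ).1

/-- **Generator form, split prime** (`e = 1`): a generator `fE` of `char_Λ X` and `g ∈ (fE)` with
`ϖ · L = T¹ · ι(g)` — the inputs `hg`, `hι` of `Typed.noPTorsion_of_leadingTerm_certificate`
(`char_Λ X` is principal: tree theorem `charIdeal_isPrincipal_holds`). [folklore] -/
theorem exists_generator_engine_shape_split {W : WeierstrassCurve ℚ} [W.IsElliptic]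
    [W.IsGloballyMinimal] {p : ℕ} [Fact p.Prime] (hdiv : MultDivisibilityAt W p)
    {κ : ZpExtension ℚ p} {γ : Field.absoluteGaloisGroup ℚ} {N : ℕ} [NeZero N]
    {f : CuspForm (Gamma0 N) 2} (hκ : κ.IsCyclotomic) (hγ : κ.IsTopGenerator γ)
    (hγ' : IsCyclotomicVariable p γ) (hf : IsNewformOf W f) (D : W.SelmerDualData κ γ) (ϖ : ℚ)
    (hϖ0 : ϖ ≠ 0) (hϖ : (ϖ : ℝ) * W.realPeriodRat = plusPeriod f)
    (hsplit : W.HasSplitMultiplicativeReductionAtPrime p)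
    (L : PowerSeries ℚ_[p]) (hL : IsSplitMultPAdicLFunctionOf f p L) :
    ∃ fE g : IwasawaAlgebra p, D.charIdeal = Ideal.span {fE} ∧ g ∈ Ideal.span {fE} ∧
      PowerSeries.C ((ϖ : ℚ) : ℚ_[p]) * L = PowerSeries.X ^ 1 * iwasawaToPowerSeries p g := by
  haveI : (Module.charIdeal (IwasawaAlgebra p) D.X).IsPrincipal := charIdeal_isPrincipal_holds p D.X
  obtain ⟨fE, hchar⟩ := Submodule.IsPrincipal.principal (Module.charIdeal (IwasawaAlgebra p) D.X)
  have hchar' : D.charIdeal = Ideal.span {fE} := hchar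
  obtain ⟨g, hg, hιg⟩ := (hdiv hκ hγ hγ' hf D ϖ hϖ0 hϖ).2.2 hsplit L hL
  refine ⟨fE, g, hchar', hchar' ▸ hg, ?_⟩
  rw [← hιg, map_mul, pow_one]
  simp [iwasawaToPowerSeries, PowerSeries.map_X]

/-- **Generator form, non-split prime** (`e = 0`): a generator `fE` of `char_Λ X` and `g ∈ (fE)`
with `ϖ · L = T⁰ · ι(g)`. [folklore] -/
theorem exists_generator_engine_shape_nonsplit {W : WeierstrassCurve ℚ} [W.IsElliptic]
    [W.IsGloballyMinimal] {p : ℕ} [Fact p.Prime] (hdiv : MultDivisibilityAt W p)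
    {κ : ZpExtension ℚ p} {γ : Field.absoluteGaloisGroup ℚ} {N : ℕ} [NeZero N]
    {f : CuspForm (Gamma0 N) 2} (hκ : κ.IsCyclotomic) (hγ : κ.IsTopGenerator γ)
    (hγ' : IsCyclotomicVariable p γ) (hf : IsNewformOf W f) (D : W.SelmerDualData κ γ) (ϖ : ℚ)
    (hϖ0 : ϖ ≠ 0) (hϖ : (ϖ : ℝ) * W.realPeriodRat = plusPeriod f)
    (hns : ¬ W.HasSplitMultiplicativeReductionAtPrime p)
    (L : PowerSeries ℚ_[p]) (hL : IsMultPAdicLFunctionOf f p (-1) L) :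
    ∃ fE g : IwasawaAlgebra p, D.charIdeal = Ideal.span {fE} ∧ g ∈ Ideal.span {fE} ∧
      PowerSeries.C ((ϖ : ℚ) : ℚ_[p]) * L = PowerSeries.X ^ 0 * iwasawaToPowerSeries p g := by
  haveI : (Module.charIdeal (IwasawaAlgebra p) D.X).IsPrincipal := charIdeal_isPrincipal_holds p D.X
  obtain ⟨fE, hchar⟩ := Submodule.IsPrincipal.principal (Module.charIdeal (IwasawaAlgebra p) D.X)
  have hchar' : D.charIdeal = Ideal.span {fE} := hchar
  obtain ⟨g, hg, hιg⟩ := (hdiv hκ hγ hγ' hf D ϖ hϖ0 hϖ).2.1 hns L hL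
  exact ⟨fE, g, hchar', hchar' ▸ hg, by rw [pow_zero, one_mul, hιg]⟩

end MultDivisibilityAt

variable {W : WeierstrassCurve ℚ} [W.IsElliptic] [W.IsGloballyMinimal] {p : ℕ} [Fact p.Prime]

/-! ### §3. The two PUBLISHED divisibility sources are instances -/

/-- **A32 ⇒ the typed input**: at `p ≥ 5` with multiplicative reduction and `ρ̄_{E,p}` ONTO,
Kato's divisibility (Wuthrich 2014 Thm. 3 / Cor. 19, named fact
`kato_charIdeal_dvd_multiplicative_of_surjective`) is `MultDivisibilityAt W p`
(surjectivity of every `ρ̄_{E,p^n}` from `Surj W p` by Serre, tree theorem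
`surjective_pow_of_five_le`). [cite: Wuthrich2014, Thm. 3 (p. 383) and Cor. 19 (p. 398)] -/
theorem multDivisibilityAt_of_surj (hK : kato_charIdeal_dvd_multiplicative_of_surjective)
    (hp5 : 5 ≤ p) (hmult : Mult W p) (hρ : Surj W p) : MultDivisibilityAt W p := by
  intro κ γ N _ f hκ hγ hγ' hf D ϖ _ hϖ
  exact hK W p (by omega) hmult
    (kato_charIdeal_dvd_multiplicative_of_surjective.surjective_pow_of_five_le W p hp5 hρ)
    hκ hγ hγ' hf D ϖ hϖ

/-- **A31 ⇒ the typed input**: at `p ≥ 3` with multiplicative reduction, (irr) and (ram), Skinner 2016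
Thm. A (named fact `thmA_charIdeal_multiplicative`, which gives the full main conjecture
`char_Λ X = (ϖ · L_p)` resp. `T · char_Λ X = (ϖ · L_p)` with a principal generator) implies
`MultDivisibilityAt W p` (take `g :=` generator `×` the unit). [cite: Skinner2016PacificMC, Thm. A (§1), §3.2] -/
theorem multDivisibilityAt_of_ram (hA : thmA_charIdeal_multiplicative) (hp : 3 ≤ p)
    (hmult : Mult W p) (hirr : Irr W p) (hram : Ram W p) : MultDivisibilityAt W p := by
  intro κ γ N _ f hκ hγ hγ' hf D ϖ hϖ0 hϖ
  obtain ⟨hT, g, hchar, hsplit, hns⟩ := hA W p hp hmult hirr hram hκ hγ hγ' hf D ϖ hϖ0 hϖ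
  have hmem : ∀ w : (IwasawaAlgebra p)ˣ, g * (w : IwasawaAlgebra p) ∈ D.charIdeal := by
    intro w
    rw [hchar]
    exact Ideal.mul_mem_right _ _ (Ideal.mem_span_singleton_self g)
  refine ⟨hT, fun hn L hL => ?_, fun hs L hL => ?_⟩
  · obtain ⟨w, hw⟩ := hns hn L hL
    exact ⟨g * (w : IwasawaAlgebra p), hmem w, hw⟩
  · obtain ⟨w, hw⟩ := hsplit hs L hL
    refine ⟨g * (w : IwasawaAlgebra p), hmem w, ?_⟩
    rw [← mul_assoc]
    exact hw

/-! ### §4. The typed input + the two-number certificate ⇒ `BSD(E,p)` (no image hypothesis, no (ram)) -/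

/-- **Split multiplicative `p ≥ 3`, analytic rank `≤ 1`, `p ∤ #Ш_an`: `MultDivisibilityAt W p` +
PUBLISHED facts (Stein–Wuthrich 2013 Thm. 6.1 `hJ` = the leading-term clause, §4.2 height existence
`hH`, Gross–Zagier–Kolyvagin `hGZK`; the `𝓛`-invariant is non-zero by the tree theorem
`LInvariant_ne_zero_holds` (Barré-Sirieix–Diaz–Gramain–Philibert)) + the per-pair COMPUTED
certificate (`hordL : ord_{T=0} L_p = r + 1`, `hcert : ord_p(ϖ · [T^{r+1}]L_p · log_p(γ_cyc)^{r+1} ·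
#E(ℚ)_tors²) = ord_p(𝓛_p · ∏ c_v · Reg_p(E))` for THE Stein–Wuthrich height — every `Dh` with
`IsSplitMultCanonical Dh Dq`, unique) + `hs`/`hv` (`p ∤ #Ш_an`) ⟹ `BSDp W p`.** NO hypothesis on
`ρ̄_{E,p}`, no (ram) prime, no semistability, no class predicate: the divisibility `hdiv` is the only
non-computational, non-published input. Proof: the engine `Typed.noPTorsion_of_leadingTerm_certificate`
with `hg`, `hι` from `hdiv` (§2), `T^r ∣ f_E` from the torsion clause
(`Typed.X_pow_mordellWeilRank_dvd_of_charIdeal_eq_span`), `hLT := hJ.leadingTerm_shape`, then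
`Typed.bsdp_of_shaAn_unit_of_noPTorsion`. Per pair; NOT a class theorem.
[cite: SteinWuthrich2013, Thm. 6.1 (p. 20) and §4.2] [cite: MazurTateTeitelbaum1986Invent, §II.10]
[cite: Miller2011LMS, §1 Def. 1.1 and Prop. 7.6] -/
theorem bsdp_of_multDivisibilityAt_split_of_certificate (hJ : thm61_splitMultiplicative)
    (hH : exists_isSplitMultCanonical) (hGZK : rank_eq_analyticRank_of_analyticRank_le_one)
    (W : WeierstrassCurve ℚ) [W.IsElliptic] [W.IsGloballyMinimal] (p : ℕ) [Fact p.Prime]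
    {κ : ZpExtension ℚ p} {γ : Field.absoluteGaloisGroup ℚ} {N : ℕ} [NeZero N]
    {f : CuspForm (Gamma0 N) 2} (hp : 3 ≤ p) (hr : W.analyticRank ≤ 1)
    (hdiv : MultDivisibilityAt W p) (Dq : TateParameterData W p)
    (hκ : κ.IsCyclotomic) (hγ : κ.IsTopGenerator γ) (hγ' : IsCyclotomicVariable p γ)
    (hf : IsNewformOf W f) (D : W.SelmerDualData κ γ) (ϖ : ℚ) (hϖ0 : ϖ ≠ 0)
    (hϖ : (ϖ : ℝ) * W.realPeriodRat = plusPeriod f)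
    (L : PowerSeries ℚ_[p]) (hL : IsSplitMultPAdicLFunctionOf f p L)
    (hordL : L.order = (W.mordellWeilRank + 1 : ℕ))
    (hcert : ∀ Dh : PAdicHeightData W p, IsSplitMultCanonical Dh Dq →
      (((ϖ : ℚ) : ℚ_[p]) * PowerSeries.coeff (W.mordellWeilRank + 1) L *
          (padicLog p (cyclotomicGenerator p) ^ (W.mordellWeilRank + 1) *
            (W.torsionOrder : ℚ_[p]) ^ 2)).valuation =
        (LInvariant Dq * (W.tamagawaProduct : ℚ_[p]) * padicRegulator Dh).valuation)
    {s : ℚ} (hs : shaAn W = (s : ℂ)) (hv : padicValRat p s = 0) : BSDp W p := by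
  obtain ⟨Dh, hDh⟩ := hH W p (by omega) Dq
  haveI : Module.Finite (IwasawaAlgebra p) D.X := D.module_finite_holds hγ
  have hXt : D.IsTorsion := hdiv.isTorsion hκ hγ hγ' hf D ϖ hϖ0 hϖ
  obtain ⟨fE, g, hchar, hg, hι⟩ :=
    hdiv.exists_generator_engine_shape_split hκ hγ hγ' hf D ϖ hϖ0 hϖ Dq.split L hL
  have hXk := X_pow_mordellWeilRank_dvd_of_charIdeal_eq_span W p hγ D hXt hchar
  have hϖQ : ((ϖ : ℚ) : ℚ_[p]) ≠ 0 := by exact_mod_cast hϖ0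
  have hc0 : (W.tamagawaProduct : ℚ_[p]) ≠ 0 := by
    exact_mod_cast (W.tamagawaProduct_pos_holds : 0 < W.tamagawaProduct).ne'
  have hA0 : LInvariant Dq * (W.tamagawaProduct : ℚ_[p]) ≠ 0 :=
    mul_ne_zero (LInvariant_ne_zero_holds Dq) hc0
  exact bsdp_of_shaAn_unit_of_noPTorsion W p hGZK hr hs hv
    (noPTorsion_of_leadingTerm_certificate W p fE g hg L ((ϖ : ℚ) : ℚ_[p]) hϖQ 1
      W.mordellWeilRank hι hordL _ _ (padicRegulator Dh) hA0 hXk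
      (hJ.leadingTerm_shape (by omega) Dq hκ hγ hγ' D hXt hDh fE hchar) (hcert Dh hDh))

/-- **Non-split multiplicative `p ≥ 3`, analytic rank `≤ 1`, `p ∤ #Ш_an`: `MultDivisibilityAt W p` +
PUBLISHED facts (SW Thm. 6.1 non-split `hJ`, height existence `hH`, GZK) + the per-pair certificate
(`hordL : ord_{T=0} L_p = r`, `hcert : ord_p(ϖ · [T^r]L_p · log_p(γ_cyc)^r · #E(ℚ)_tors²) =
ord_p(2 · ∏ c_v · Reg_p(E))` for THE SW height, formula (4.1): every `Dh` with `IsMultCanonical Dh q`,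
`q` the Tate parameter) + `hs`/`hv` ⟹ `BSDp W p`.** No image hypothesis, no (ram). Per pair.
[cite: SteinWuthrich2013, Thm. 6.1 (p. 20), §3.1 (p. 9) and §4.2] [cite: Miller2011LMS, §1 Def. 1.1 and Prop. 7.6] -/
theorem bsdp_of_multDivisibilityAt_nonsplit_of_certificate (hJ : thm61_nonsplitMultiplicative)
    (hH : exists_isMultCanonical) (hGZK : rank_eq_analyticRank_of_analyticRank_le_one)
    (W : WeierstrassCurve ℚ) [W.IsElliptic] [W.IsGloballyMinimal] (p : ℕ) [Fact p.Prime]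
    {κ : ZpExtension ℚ p} {γ : Field.absoluteGaloisGroup ℚ} {N : ℕ} [NeZero N]
    {f : CuspForm (Gamma0 N) 2} (hp : 3 ≤ p) (hr : W.analyticRank ≤ 1)
    (hdiv : MultDivisibilityAt W p) (hmult : Mult W p)
    (hns : ¬ W.HasSplitMultiplicativeReductionAtPrime p)
    {q : ℚ_[p]} (hq0 : q ≠ 0) (hq1 : ‖q‖ < 1) (hqj : tateJ q = (W.j : ℚ_[p]))
    (hκ : κ.IsCyclotomic) (hγ : κ.IsTopGenerator γ) (hγ' : IsCyclotomicVariable p γ)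
    (hf : IsNewformOf W f) (D : W.SelmerDualData κ γ) (ϖ : ℚ) (hϖ0 : ϖ ≠ 0)
    (hϖ : (ϖ : ℝ) * W.realPeriodRat = plusPeriod f)
    (L : PowerSeries ℚ_[p]) (hL : IsMultPAdicLFunctionOf f p (-1) L)
    (hordL : L.order = (W.mordellWeilRank : ℕ))
    (hcert : ∀ Dh : PAdicHeightData W p, IsMultCanonical Dh q →
      (((ϖ : ℚ) : ℚ_[p]) * PowerSeries.coeff W.mordellWeilRank L *
          (padicLog p (cyclotomicGenerator p) ^ W.mordellWeilRank *
            (W.torsionOrder : ℚ_[p]) ^ 2)).valuation =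
        (2 * (W.tamagawaProduct : ℚ_[p]) * padicRegulator Dh).valuation)
    {s : ℚ} (hs : shaAn W = (s : ℂ)) (hv : padicValRat p s = 0) : BSDp W p := by
  obtain ⟨Dh, hDh⟩ := hH W p (by omega) hmult hns q hq0 hq1 hqj
  haveI : Module.Finite (IwasawaAlgebra p) D.X := D.module_finite_holds hγ
  have hXt : D.IsTorsion := hdiv.isTorsion hκ hγ hγ' hf D ϖ hϖ0 hϖ
  obtain ⟨fE, g, hchar, hg, hι⟩ :=
    hdiv.exists_generator_engine_shape_nonsplit hκ hγ hγ' hf D ϖ hϖ0 hϖ hns L hL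
  have hXk := X_pow_mordellWeilRank_dvd_of_charIdeal_eq_span W p hγ D hXt hchar
  have hϖQ : ((ϖ : ℚ) : ℚ_[p]) ≠ 0 := by exact_mod_cast hϖ0
  have hc0 : (W.tamagawaProduct : ℚ_[p]) ≠ 0 := by
    exact_mod_cast (W.tamagawaProduct_pos_holds : 0 < W.tamagawaProduct).ne'
  have hA0 : (2 : ℚ_[p]) * (W.tamagawaProduct : ℚ_[p]) ≠ 0 := mul_ne_zero two_ne_zero hc0
  have hordL' : L.order = (W.mordellWeilRank + 0 : ℕ) := by rw [Nat.add_zero]; exact hordL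
  have hcert' : (((ϖ : ℚ) : ℚ_[p]) * PowerSeries.coeff (W.mordellWeilRank + 0) L *
      (padicLog p (cyclotomicGenerator p) ^ W.mordellWeilRank * (W.torsionOrder : ℚ_[p]) ^ 2)).valuation =
      (2 * (W.tamagawaProduct : ℚ_[p]) * padicRegulator Dh).valuation := by
    rw [Nat.add_zero]; exact hcert Dh hDh
  exact bsdp_of_shaAn_unit_of_noPTorsion W p hGZK hr hs hv
    (noPTorsion_of_leadingTerm_certificate W p fE g hg L ((ϖ : ℚ) : ℚ_[p]) hϖQ 0
      W.mordellWeilRank hι hordL' _ _ (padicRegulator Dh) hA0 hXk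
      (hJ.leadingTerm_shape (by omega) hmult hns hq0 hq1 hqj hκ hγ hγ' D hXt hDh fE hchar) hcert')

/-! ### §5. On the cell's class X11b -/

/-- **Class X11b (`r_an = 1 ∧ p ≠ 2 ∧ mult ∧ irr`), SPLIT multiplicative `p ≥ 3`: the typed
divisibility at the pair + the two-number certificate + `p ∤ #Ш_an` ⟹ `BSD(E,p)`** — whatever the
image of `ρ̄_{E,p}` (surjective, 5S4, 5Ns, …) and whether or not a (ram) prime exists. This is the
exact residue statement of the unit's three RESISTANT pairs `84960d1`, `296240ce1`, `304560by1` @ 5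
(split, `#Ш_an = 1`): each is `MultDivisibilityAt E 5` away from a kernel `BSD(E,5)`, the certificate
being a finite computation. Per pair; X11b stays CONSTRUCTION-SHAPED; nothing is claimed about the
three pairs here. [cite: SteinWuthrich2013, Thm. 6.1 (p. 20) and §4.2] [cite: Miller2011LMS, Prop. 7.6] -/
theorem ClassX11b.bsdp_of_multDivisibilityAt_split_of_certificate (hJ : thm61_splitMultiplicative)
    (hH : exists_isSplitMultCanonical) (hGZK : rank_eq_analyticRank_of_analyticRank_le_one)
    (W : WeierstrassCurve ℚ) [W.IsElliptic] [W.IsGloballyMinimal] (p : ℕ) [Fact p.Prime]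
    {κ : ZpExtension ℚ p} {γ : Field.absoluteGaloisGroup ℚ} {N : ℕ} [NeZero N]
    {f : CuspForm (Gamma0 N) 2} (hp : 3 ≤ p) (hX : ClassX11b W p)
    (hdiv : MultDivisibilityAt W p) (Dq : TateParameterData W p)
    (hκ : κ.IsCyclotomic) (hγ : κ.IsTopGenerator γ) (hγ' : IsCyclotomicVariable p γ)
    (hf : IsNewformOf W f) (D : W.SelmerDualData κ γ) (ϖ : ℚ) (hϖ0 : ϖ ≠ 0)
    (hϖ : (ϖ : ℝ) * W.realPeriodRat = plusPeriod f)
    (L : PowerSeries ℚ_[p]) (hL : IsSplitMultPAdicLFunctionOf f p L)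
    (hordL : L.order = (W.mordellWeilRank + 1 : ℕ))
    (hcert : ∀ Dh : PAdicHeightData W p, IsSplitMultCanonical Dh Dq →
      (((ϖ : ℚ) : ℚ_[p]) * PowerSeries.coeff (W.mordellWeilRank + 1) L *
          (padicLog p (cyclotomicGenerator p) ^ (W.mordellWeilRank + 1) *
            (W.torsionOrder : ℚ_[p]) ^ 2)).valuation =
        (LInvariant Dq * (W.tamagawaProduct : ℚ_[p]) * padicRegulator Dh).valuation)
    {s : ℚ} (hs : shaAn W = (s : ℂ)) (hv : padicValRat p s = 0) : BSDp W p :=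
  X11b.bsdp_of_multDivisibilityAt_split_of_certificate hJ hH hGZK W p hp (le_of_eq hX.1) hdiv Dq hκ hγ hγ'
    hf D ϖ hϖ0 hϖ L hL hordL hcert hs hv

/-- **Class X11b, NON-split multiplicative `p ≥ 3`**: the same from the non-split clause (`e = 0`,
`ε_p = 2`). Per pair. [cite: SteinWuthrich2013, Thm. 6.1 (p. 20), §3.1 (p. 9) and §4.2] [cite: Miller2011LMS, Prop. 7.6] -/
theorem ClassX11b.bsdp_of_multDivisibilityAt_nonsplit_of_certificate (hJ : thm61_nonsplitMultiplicative)
    (hH : exists_isMultCanonical) (hGZK : rank_eq_analyticRank_of_analyticRank_le_one)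
    (W : WeierstrassCurve ℚ) [W.IsElliptic] [W.IsGloballyMinimal] (p : ℕ) [Fact p.Prime]
    {κ : ZpExtension ℚ p} {γ : Field.absoluteGaloisGroup ℚ} {N : ℕ} [NeZero N]
    {f : CuspForm (Gamma0 N) 2} (hp : 3 ≤ p) (hX : ClassX11b W p)
    (hdiv : MultDivisibilityAt W p) (hns : ¬ W.HasSplitMultiplicativeReductionAtPrime p)
    {q : ℚ_[p]} (hq0 : q ≠ 0) (hq1 : ‖q‖ < 1) (hqj : tateJ q = (W.j : ℚ_[p]))
    (hκ : κ.IsCyclotomic) (hγ : κ.IsTopGenerator γ) (hγ' : IsCyclotomicVariable p γ)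
    (hf : IsNewformOf W f) (D : W.SelmerDualData κ γ) (ϖ : ℚ) (hϖ0 : ϖ ≠ 0)
    (hϖ : (ϖ : ℝ) * W.realPeriodRat = plusPeriod f)
    (L : PowerSeries ℚ_[p]) (hL : IsMultPAdicLFunctionOf f p (-1) L)
    (hordL : L.order = (W.mordellWeilRank : ℕ))
    (hcert : ∀ Dh : PAdicHeightData W p, IsMultCanonical Dh q →
      (((ϖ : ℚ) : ℚ_[p]) * PowerSeries.coeff W.mordellWeilRank L *
          (padicLog p (cyclotomicGenerator p) ^ W.mordellWeilRank *
            (W.torsionOrder : ℚ_[p]) ^ 2)).valuation =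
        (2 * (W.tamagawaProduct : ℚ_[p]) * padicRegulator Dh).valuation)
    {s : ℚ} (hs : shaAn W = (s : ℂ)) (hv : padicValRat p s = 0) : BSDp W p :=
  X11b.bsdp_of_multDivisibilityAt_nonsplit_of_certificate hJ hH hGZK W p hp (le_of_eq hX.1) hdiv hX.2.2.1
    hns hq0 hq1 hqj hκ hγ hγ' hf D ϖ hϖ0 hϖ L hL hordL hcert hs hv

/-! ### §6. (gen 5 append) The reducible case is an instance too: at `p ∥ N` the typed input is a
THEOREM from published facts in every case except the small irreducible image without (ram) -/

/-- **A33 ⇒ the typed input**: at an odd multiplicative prime with `E[p]` REDUCIBLE (class X2), Wuthrich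
2014 Thm. 16 (multiplicative clauses; named fact `thm16_charIdeal_dvd_multiplicative_of_reducible`, PUB)
is `MultDivisibilityAt W p` — so the typed input of this file is uniform over X2 ∪ X11b at `p ∥ N`,
and on X2 it is SUPPLIED (lever L3: `Typed.X2.bsdp_of_thm16mult_{split,nonsplit}_of_certificate` is the
corresponding per-pair certificate consumer). [cite: Wuthrich2014, Thm. 16 (p. 397)] -/
theorem multDivisibilityAt_of_red (h16 : thm16_charIdeal_dvd_multiplicative_of_reducible)
    (hp : p ≠ 2) (hmult : Mult W p) (hred : Red W p) : MultDivisibilityAt W p := by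
  intro κ γ N _ f hκ hγ hγ' hf D ϖ _ hϖ
  exact h16 W p hp hmult hred hκ hγ hγ' hf D ϖ hϖ

/-- **At a multiplicative prime `p ≥ 5` the typed input `MultDivisibilityAt W p` is a THEOREM from the
three PUBLISHED divisibility facts in every case EXCEPT `Irr ∧ ¬Surj ∧ ¬Ram`** (irreducible small image
— 5S4 / Cartan normalisers — with no (ram) prime: the X9-analogue at `p ∥ N`, the unit's 64 beyond-window
pairs, 3 of them resistant): reducible ⇒ A33 (Wuthrich Thm. 16); surjective ⇒ A32 (Kato–Wuthrich);
irreducible with a (ram) prime ⇒ A31 (Skinner 2016 Thm. A). A disjunction-elimination over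
`multDivisibilityAt_of_red` / `_of_surj` / `_of_ram`; nothing new asserted.
[cite: Wuthrich2014, Thm. 3, Thm. 16, Cor. 19] [cite: Skinner2016PacificMC, Thm. A (§1)] -/
theorem multDivisibilityAt_of_published (h16 : thm16_charIdeal_dvd_multiplicative_of_reducible)
    (hK : kato_charIdeal_dvd_multiplicative_of_surjective) (hA : thmA_charIdeal_multiplicative)
    (hp5 : 5 ≤ p) (hmult : Mult W p) (hcase : Red W p ∨ Surj W p ∨ (Irr W p ∧ Ram W p)) :
    MultDivisibilityAt W p := by
  rcases hcase with hred | hsurj | ⟨hirr, hram⟩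
  · exact multDivisibilityAt_of_red h16 (by omega) hmult hred
  · exact multDivisibilityAt_of_surj hK hp5 hmult hsurj
  · exact multDivisibilityAt_of_ram hA (by omega) hmult hirr hram

end Summit.BirchSwinnertonDyer.Rank1Residual.X11b

end
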